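import Summits.CriticalPhenomena.CardyFormulaZ2.Theses.CardyRotToConf
import Literature.Probability.RandomPlanarGeometry.SLESwallowingTimeZero
import HarnessLib

/-!
# Swallowing times of small real points tend to zero (stub R2 of the SLE₆ regularity programme,
# crux `CardyRotToConfR2SymmetryUpgrade`, stmt-CriticalPhenomena-0698)

Stub `stub_sleSwallowingTimeTendstoZero` of line `germ-label-transport` (lead skeleton
`CardyRotToConfR2SymmetryUpgrade`, brick R2 of the arc-confinement regularity of the SLE_κ trace
used by `stub_secondFamily`): for chordal SLE_κ with `κ > 4`, almost surely the swallowing times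
`T_{1/(k+1)}` of the small positive real points `1/(k+1) ↓ 0` tend to `0` — the trace touches
`ℝ ∖ {0}` at arbitrarily small positive times. This file is the registered one-line form of the
Literature theorem `ae_tendsto_swallowingTime_zero` of
`Literature/Probability/RandomPlanarGeometry/SLESwallowingTimeZero.lean`, where the mathematics
lives (a.s. `T_x < ∞`, Lawler (2005), Prop. 6.8; Brownian scaling `T_{cx} ∼ c² T_x`, Prop. 6.5;
monotonicity of `x ↦ T_x`); the same file transfers the statement to the driving function after
an optional time (`ae_tendsto_swallowingTime_sleDrivingAfter_zero`) and to the hitting time of a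
closed set by the trace (`ae_tendsto_swallowingTime_sleDrivingAfter_hitting_zero`).

References: G. F. Lawler, *Conformally Invariant Processes in the Plane* (2005), Prop. 6.5,
Prop. 6.8; S. Rohde, O. Schramm, *Basic properties of SLE*, Ann. of Math. 161 (2005), Lemma 6.5,
§7.
-/

noncomputable section

open MeasureTheory Filter
open Literature.Probability Literature.Probability.RandomPlanarGeometry

namespace Summit.CriticalPhenomena.CardyFormulaZ2.Theorems.CardyRotToConfR2SymmetryUpgrade

/-- **Stub `stub_sleSwallowingTimeTendstoZero`** (brick R2, registered form): for chordal SLE_κ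
with `κ > 4`, almost surely `T_{1/(k+1)} → 0` as `k → ∞` (`0 = ⊥` in `WithTop ℝ≥0`, order
topology) — `ae_tendsto_swallowingTime_zero`. Lawler (2005), Prop. 6.8 with Prop. 6.5;
Rohde–Schramm (2005), Lemma 6.5. -/
theorem stub_sleSwallowingTimeTendstoZero : ∀ {κ : NNReal}, 4 < κ → ∀ᵐ ω ∂Process.preWienerMeasure, Filter.Tendsto (fun k : ℕ ↦ Loewner.swallowingTime (sleDriving κ ω) ((((1 : ℝ) / ((k : ℝ) + 1) : ℝ)) : ℂ)) Filter.atTop (nhds 0) :=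
  fun hκ ↦ ae_tendsto_swallowingTime_zero hκ

end Summit.CriticalPhenomena.CardyFormulaZ2.Theorems.CardyRotToConfR2SymmetryUpgrade
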